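import Summits.MatrixMultiplication.OmegaCensus.SmallFormats.MatMul22nRankGF7Slack4Search
import HarnessLib

/-!
# ω-census family (a): slack-4 search certificate replay, classes 31–106 (part 2 of 3)

Cell `pub-omega` (unit `pub-omega-tensor-g15`), topic `Summits/MatrixMultiplication/OmegaCensus` (sub-folder `SmallFormats`).
Framing (verbatim): lottery ticket; floor = certified bounds/negative ranges. HONEST FRAMING: kernel replays of the slack-4 search certificate
(`MatMul22nRankGF7Slack4Search`; generated by `pub-omega-tensor-g15/code/gen_runfiles.py`); meaning only through
`MatMul22nRankGF7Slack4SearchSound2.search7_sound`. Nothing here is progress on `ω`.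
-/

namespace Summit.MatrixMultiplication.OmegaCensus.SmallFormats

set_option maxRecDepth 100000 in
set_option maxHeartbeats 40000000 in
/-- `search7 c` for `31 ≤ c < 39` (1910 search nodes). -/
theorem search7_ok_2_1 : ∀ c : Fin 120, 31 ≤ c.val → c.val < 39 → search7 c.val = true := by decide +kernel

set_option maxRecDepth 100000 in
set_option maxHeartbeats 40000000 in
/-- `search7 c` for `39 ≤ c < 45` (2450 search nodes). -/
theorem search7_ok_2_2 : ∀ c : Fin 120, 39 ≤ c.val → c.val < 45 → search7 c.val = true := by decide +kernel

set_option maxRecDepth 100000 in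
set_option maxHeartbeats 40000000 in
/-- `search7 c` for `45 ≤ c < 92` (1980 search nodes). -/
theorem search7_ok_2_3 : ∀ c : Fin 120, 45 ≤ c.val → c.val < 92 → search7 c.val = true := by decide +kernel

set_option maxRecDepth 100000 in
set_option maxHeartbeats 40000000 in
/-- `search7 c` for `92 ≤ c < 107` (3296 search nodes). -/
theorem search7_ok_2_4 : ∀ c : Fin 120, 92 ≤ c.val → c.val < 107 → search7 c.val = true := by decide +kernel

/-- `search7 c` for `31 ≤ c < 107`. -/
theorem search7_ok_2 {c : ℕ} (h1 : 31 ≤ c) (h2 : c < 107) : search7 c = true := by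
  by_cases hb1 : c < 39
  · exact search7_ok_2_1 ⟨c, by omega⟩ (by show 31 ≤ c; omega) hb1
  by_cases hb2 : c < 45
  · exact search7_ok_2_2 ⟨c, by omega⟩ (by show 39 ≤ c; omega) hb2
  by_cases hb3 : c < 92
  · exact search7_ok_2_3 ⟨c, by omega⟩ (by show 45 ≤ c; omega) hb3
  exact search7_ok_2_4 ⟨c, by omega⟩ (by show 92 ≤ c; omega) (by show c < 107; omega)

end Summit.MatrixMultiplication.OmegaCensus.SmallFormats
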